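import Mathlib
import HarnessLib

/-!
# Closed points of the special fibre are rational over the residue field

Stub `exists_point_of_isClosed` of the line `strata-split` for the crux `EquisingularLift`
(stmt-ResolutionOfSingularities-15660).

Let `(O, 𝔪, κ)` be a local ring with algebraically closed residue field `κ = O/𝔪`,
`r₁ : P₁ → Spec O` a morphism locally of finite type and `x₀ ∈ P₁` a closed point lying over the
closed point of `Spec O`. Then `x₀` is the image of a `κ`-point `x : Spec κ → P₁` compatible with
`Spec κ → Spec O`.

Proof: the special fibre `F = P₁ ×_{Spec O} Spec κ` is locally of finite type over `Spec κ` (base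
change) and the projection `F → P₁` is a closed immersion (base change of the closed immersion
`Spec κ → Spec O`, `Spec` of the surjection `O → κ`) whose range `r₁⁻¹(𝔪)` contains `x₀`; the point
`f₀ ∈ F` over `x₀` is closed, hence — `κ` being algebraically closed — underlies a `κ`-rational point
of `F` (Hilbert's Nullstellensatz, Mathlib's `AlgebraicGeometry.pointOfClosedPoint`), whose
composite with `F → P₁` is the required `x`.

References: R. Hartshorne, *Algebraic Geometry*, II Ex. 2.7, II.3 (fibres); Q. Liu, *Algebraic
Geometry and Arithmetic Curves*, OUP 2002, Prop. 3.1.16 and Cor. 2.1.12 (Nullstellensatz).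
-/

set_option linter.dupNamespace false -- mandated namespace of this single-conjunct summit

namespace Summit.ResolutionOfSingularities.ResolutionOfSingularities.Cruxes.EquisingularLift.StrataSplit

open CategoryTheory AlgebraicGeometry TopologicalSpace

/-- **Closed points of the special fibre are `κ`-rational.** For a local ring `O` with
algebraically closed residue field `κ`, a morphism `r₁ : P₁ → Spec O` locally of finite type and a
closed point `x₀ ∈ P₁` over the closed point of `Spec O`, there is a `κ`-point
`x : Spec κ → P₁` over `Spec κ → Spec O` with image `x₀` (base change to the special fibre and
Hilbert's Nullstellensatz, Mathlib `AlgebraicGeometry.pointOfClosedPoint`). [folklore] -/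
theorem exists_point_of_isClosed : ∀ (O : Type) [CommRing O] [IsLocalRing O]
    [IsAlgClosed (IsLocalRing.ResidueField O)] (P₁ : AlgebraicGeometry.Scheme.{0})
    (r₁ : P₁ ⟶ AlgebraicGeometry.Spec (.of O)), AlgebraicGeometry.LocallyOfFiniteType r₁ →
    ∀ x₀ : P₁, IsClosed ({x₀} : Set P₁) → r₁ x₀ = IsLocalRing.closedPoint O →
    ∃ x : AlgebraicGeometry.Spec (.of (IsLocalRing.ResidueField O)) ⟶ P₁,
      x ≫ r₁ = AlgebraicGeometry.Spec.map (CommRingCat.ofHom (IsLocalRing.residue O)) ∧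
        Set.range x = {x₀} := by
  intro O _ _ _ P₁ r₁ hr₁ x₀ hx₀ hrx₀
  -- `Spec κ → Spec O` is a closed immersion onto the closed point
  set s : Spec (.of (IsLocalRing.ResidueField O)) ⟶ Spec (.of O) :=
    Spec.map (CommRingCat.ofHom (IsLocalRing.residue O))
  have hs : ∀ a, s a = IsLocalRing.closedPoint O := fun a ↦ by
    rw [Spec.map_apply, CommRingCat.hom_ofHom]
    exact IsLocalRing.PrimeSpectrum.comap_residue O a
  haveI : IsClosedImmersion s :=
    IsClosedImmersion.spec_of_surjective _ IsLocalRing.residue_surjective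
  -- a point `f₀` of the special fibre `F = P₁ ×_O κ` over `x₀`; it is closed since `F → P₁` is a
  -- closed immersion
  obtain ⟨f₀, hf₀, -⟩ := Scheme.Pullback.exists_preimage_pullback (f := r₁) (g := s) x₀
    (IsLocalRing.closedPoint (IsLocalRing.ResidueField O)) (hrx₀.trans (hs _).symm)
  have hcl : IsClosed ({f₀} : Set ↑(Limits.pullback r₁ s)) := by
    convert hx₀.preimage (Limits.pullback.fst r₁ s).continuous using 1
    refine Set.ext fun z ↦ ⟨?_, fun hz ↦ ?_⟩
    · rintro rfl
      exact hf₀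
    · exact (Limits.pullback.fst r₁ s).isClosedEmbedding.injective (hz.trans hf₀.symm)
  -- `F → Spec κ` is locally of finite type and `κ` is algebraically closed: `f₀` is `κ`-rational
  refine ⟨pointOfClosedPoint (Limits.pullback.snd r₁ s) f₀ hcl ≫ Limits.pullback.fst r₁ s, ?_, ?_⟩
  · rw [Category.assoc, Limits.pullback.condition, pointOfClosedPoint_comp_assoc]
  · refine Set.ext fun y ↦ ⟨?_, ?_⟩
    · rintro ⟨a, rfl⟩
      rw [Scheme.Hom.comp_apply, pointOfClosedPoint_apply]
      exact hf₀
    · rintro rfl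
      refine ⟨IsLocalRing.closedPoint _, ?_⟩
      rw [Scheme.Hom.comp_apply, pointOfClosedPoint_apply]
      exact hf₀

end Summit.ResolutionOfSingularities.ResolutionOfSingularities.Cruxes.EquisingularLift.StrataSplit
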